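import Summits.QuantumFields.YangMills.Theorems.InfiniteVolumeContinuumOctaveDoublingDefs
import Summits.QuantumFields.YangMills.Theorems.InfiniteVolumeContinuumOctaveDoublingPlaneCovariance
import Summits.QuantumFields.YangMills.Theorems.InfiniteVolumeContinuumTemperedCalibrationK
import Summits.QuantumFields.YangMills.Theorems.InfiniteVolumeContinuumTemperedMomentBoundA
import Summits.QuantumFields.YangMills.Theorems.InfiniteVolumeContinuumWeightedWhitneyPkg
import HarnessLib

/-!
# LINE «OctaveDoubling» on the leaf 19868: the composition BY NAME modulo the open stubs, and the large-`R` ∕ new-octave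
# reductions of D1 `PinnedTopOctaveCeiling` and D2 `PinnedOctaveStep`

Registered skeleton `Cruxes/HypercubicOSDataFromInfiniteVolume/Lines/octave_doubling.lean` REV 2.1 (sha16 a67e571407d40d37); registry
after W ✓p781979, CAL ✓p782165, E3T (`stub_temperedMomentBoundA`): OPEN = N `stub_onsetFloorsK`, D1, D2, K2R (= item 28168).

* §1 `hypercubicOSData_of_octaves : OnsetFloorsK → PinnedTopOctaveCeiling → PinnedOctaveStep → AtomicSqrtDominationR → leaf` —
  the leaf `InfiniteVolumeContinuum.HypercubicOSDataFromInfiniteVolume` BY NAME from exactly the four open registered stubs, every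
  other arrow being a tree theorem (landed CAL, W, E3T, the dyadic reduction `pinnedTempered_of_octaves`, the K4 engine).
* §2 **D2 core reduction** `pinnedOctaveStep_of_core`: to prove D2 it suffices to prove its conclusion for `R ≥ R₀` (any fixed
  `R₀`) and on the NEW octave `t ≤ 4R+1` only — on `t ∈ [4R+2, L]` the conclusion is the hypothesis (`K ≥ 1`), and on `R < R₀`
  it is the a priori bound `|c| ≤ 4N² ≤ (2N R₀⁴/R⁴)²` (`PlaneCovariance.abs_torusCov_plane_le_sq`, `C₀ := max C₀ (2N R₀⁴)`).
* §3 **D1 large-`R` reduction** `pinnedTopOctaveCeiling_of_largeR`: likewise D1 ⟸ D1 on `R ≥ R₀` (`C := max C (2N R₀⁴)`,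
  slack factor `(ℓ₄/(Rs))^M ≥ 1`).

So the CONTENT of both D-stubs sits at `R → ∞`, i.e. at sub-unit physical scales `Rs ≤ ℓ₄` with the pinned onset scale `s → 0`
(hyperscaling `R⁻⁸` on one octave for D1; factor-`K` UV-ward regularity per octave for D2) — the a priori weak-coupling decay
`|c| ≤ 2N²η(β)` (`PlaneCovariance.abs_torusCov_plane_le_of_weakCoupling`) is uniform but carries no power of `R`.

HONEST LABEL: bookkeeping on HYPOTHESES (implications between open Props) plus elementary a priori estimates; no stub of wall class,
no crux, rung, leaf or summit is proved; nothing about Bałaban's RG or Clay is asserted; the Yang–Mills mass gap is NOT proved.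
Prover seat `ymfull-r2a-prover-2` g0 (R590-ym item (14)), 2026-08-30.
-/

set_option autoImplicit false

noncomputable section

open scoped BigOperators
open MeasureTheory Filter Topology
open Literature.MathematicalPhysics.QuantumFieldTheory Literature.MathematicalPhysics.QuantumLattice
open Summit.QuantumFields.YangMills.Cruxes.OSLegsFromFemtoAndGap.DlrCollarTransfer (Q2 Q3 torusE plane)
open Summit.QuantumFields.YangMills.Cruxes.AtomicCalibrationR.MirrorCalibration (OnsetFloorsK)
open Summit.QuantumFields.YangMills.Theses.OnsetTautology (AtomicSqrtDominationR)
open Summit.QuantumFields.YangMills.Theorems.InfiniteVolumeContinuum.PlaneCovariance (abs_torusCov_plane_le_sq)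

namespace Summit.QuantumFields.YangMills.Cruxes.HypercubicOSDataFromInfiniteVolume.TemperedCurrencies

/-! ## §1 The leaf BY NAME modulo the four open registered stubs -/

/-- **Composition modulo the open stubs.**  The leaf 19868 BY NAME from N `OnsetFloorsK`, D1 `PinnedTopOctaveCeiling`,
D2 `PinnedOctaveStep` and K2R `AtomicSqrtDominationR` (item 28168); every other arrow is a tree theorem: CAL
`stub_temperedCalibrationK` ✓p782165, the dyadic reduction `pinnedTempered_of_octaves`, W `stub_weightedWhitneyPkg` ✓p781979,
E3T `stub_temperedMomentBoundA`, and the engine corollary `hypercubicOSData_of_temperedA` ✓p781740. [bookkeeping on hypotheses] -/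
theorem hypercubicOSData_of_octaves (hN : OnsetFloorsK) (hD1 : PinnedTopOctaveCeiling) (hD2 : PinnedOctaveStep)
    (h68 : AtomicSqrtDominationR) :
    Summit.QuantumFields.YangMills.Theses.InfiniteVolumeContinuum.HypercubicOSDataFromInfiniteVolume :=
  hypercubicOSData_of_temperedA (stub_temperedCalibrationK hN (pinnedTempered_of_octaves hD1 hD2))
    (stub_temperedMomentBoundA stub_weightedWhitneyPkg h68)

/-! ## §2 D2: the core reduction (large `R`, new octave only) -/

/-- An auxiliary numerical fact: for `1 ≤ R < R₀`, `4N² ≤ (2N R₀⁴ / R⁴)²`. -/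
theorem four_sq_le_of_lt (N : ℝ) {R R₀ : ℕ} (hR : 1 ≤ R) (hRR : R < R₀) :
    4 * N ^ 2 ≤ (2 * N * (R₀ : ℝ) ^ 4 / (R : ℝ) ^ 4) ^ 2 := by
  have hr : (0 : ℝ) < R := by exact_mod_cast hR
  have hle : (R : ℝ) ≤ R₀ := by exact_mod_cast hRR.le
  have h1 : 1 ≤ (R₀ : ℝ) ^ 4 / (R : ℝ) ^ 4 := by
    rw [one_le_div (by positivity)]
    exact pow_le_pow_left₀ hr.le hle 4
  have h2 : 2 * N * (R₀ : ℝ) ^ 4 / (R : ℝ) ^ 4 = 2 * N * ((R₀ : ℝ) ^ 4 / (R : ℝ) ^ 4) := by ring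
  rw [h2, mul_pow]
  calc 4 * N ^ 2 = (2 * N) ^ 2 * 1 := by ring
    _ ≤ (2 * N) ^ 2 * ((R₀ : ℝ) ^ 4 / (R : ℝ) ^ 4) ^ 2 := by gcongr; exact one_le_pow₀ h1

/-- **D2 core reduction.**  Fix any `R₀ : ℕ`.  If the D2 statement holds with its conclusion owed only for `R₀ ≤ R` and only on
the NEW octave `t ≤ 4R+1` (hypotheses inserted after `1 ≤ R` and after `t ≤ L`; everything else VERBATIM), then D2
`PinnedOctaveStep` holds: on `t ∈ [4R+2, L]` the bound `B` is the hypothesis and `B ≤ K·max(B, ·)` because `K ≥ 1` and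
`B ≥ |c(4R+2)| ≥ 0`; on `R < R₀` the a priori bound `|c| ≤ 4N² ≤ (2N R₀⁴/R⁴)²` does it with `C₀ := max C₀ (2N R₀⁴)`.
[bookkeeping + a priori bound] -/
theorem pinnedOctaveStep_of_core (R₀ : ℕ)
    (h : ∀ (G : Type) [Group G] [TopologicalSpace G] [IsTopologicalGroup G] [CompactSpace G],
      IsCompactSimpleLieGroup G → Nonempty (G ≃ₜ* Matrix.specialUnitaryGroup (Fin 2) ℂ) →
      letI : MeasurableSpace G := borel G
      haveI : BorelSpace G := ⟨rfl⟩
      ∀ (r : LatticeRep G) (v f g h : SchwartzMap (EuclideanSpace ℝ (Fin 4)) ℝ) (Λ₅ : ℝ), ∃ ε₀ : ℝ, 0 < ε₀ ∧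
        ∀ ε : ℝ, 0 < ε → ε ≤ ε₀ →
          (∃ β₅ : ℝ, ∀ β : ℝ, β₅ ≤ β → ∃ s : ℝ, 0 < s ∧ s ≤ 1 ∧
              (∀ L : ℕ, Λ₅ ≤ s * L → ε ≤ Q2 G r β L s (thetaTest 4 v) v) ∧
              (∀ L : ℕ, Λ₅ ≤ s * L → ε ≤ |Q3 G r β L s f g h|)) →
          ∃ (K C₀ ℓ₄ β₄ : ℝ), 0 < ℓ₄ ∧ 1 ≤ K ∧ 0 ≤ C₀ ∧ ∀ β : ℝ, β₄ ≤ β → ∀ s : ℝ, 0 < s → s ≤ 1 →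
            (∀ s' : ℝ, 2 * s ≤ s' → s' ≤ 1 →
              ¬ ((∀ L : ℕ, Λ₅ ≤ s' * L → ε ≤ Q2 G r β L s' (thetaTest 4 v) v) ∧
                 (∀ L : ℕ, Λ₅ ≤ s' * L → ε ≤ |Q3 G r β L s' f g h|))) →
            ((∀ L : ℕ, Λ₅ ≤ s * L → ε ≤ Q2 G r β L s (thetaTest 4 v) v) ∧
              (∀ L : ℕ, Λ₅ ≤ s * L → ε ≤ |Q3 G r β L s f g h|)) →
            ∀ (L : ℕ) (q : Fin 4 × Fin 4) (k : Fin 4) (R : ℕ) (B : ℝ), q.1 < q.2 → 1 ≤ R → R₀ ≤ R →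
              2 * (R : ℝ) * s ≤ ℓ₄ → 8 * R + 8 ≤ L →
              (∀ t' : ℕ, 4 * R + 2 ≤ t' → t' ≤ L →
                |torusE G r β L (fun U =>
                  (plane G r q (fun i => if i = k then (t' : ℤ) else 0) U -
                      torusE G r β L (plane G r q (fun i => if i = k then (t' : ℤ) else 0))) *
                    (plane G r q (fun _ => 0) U - torusE G r β L (plane G r q (fun _ => 0))))| ≤ B) →
              ∀ t : ℕ, 2 * R + 2 ≤ t → t ≤ L → t ≤ 4 * R + 1 →
              |torusE G r β L (fun U =>
                  (plane G r q (fun i => if i = k then (t : ℤ) else 0) U -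
                      torusE G r β L (plane G r q (fun i => if i = k then (t : ℤ) else 0))) *
                    (plane G r q (fun _ => 0) U - torusE G r β L (plane G r q (fun _ => 0))))| ≤
                K * max B ((C₀ / (R : ℝ) ^ 4) ^ 2)) :
    PinnedOctaveStep := by
  intro G _ _ _ _ hG hcl
  letI : MeasurableSpace G := borel G
  haveI : BorelSpace G := ⟨rfl⟩
  intro r v f g h' Λ₅
  obtain ⟨ε₀, hε₀, H⟩ := h G hG hcl r v f g h' Λ₅
  refine ⟨ε₀, hε₀, fun ε hε hεε hfl => ?_⟩
  obtain ⟨K, C₀, ℓ₄, β₄, hℓ₄, hK, hC₀, H'⟩ := H ε hε hεε hfl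
  refine ⟨K, max C₀ (2 * r.N * (R₀ : ℝ) ^ 4), ℓ₄, β₄, hℓ₄, hK, le_max_of_le_left hC₀, ?_⟩
  intro β hβ s hs hs1 hsub hpin L q k R B hq hR h2Rs h8 hB t hRt htL
  have hK0 : (0 : ℝ) ≤ K := zero_le_one.trans hK
  have hr : (0 : ℝ) < R := by exact_mod_cast hR
  -- `B ≥ 0`: the doubled octave is non-empty
  have hB0 : 0 ≤ B := (abs_nonneg _).trans (hB (4 * R + 2) le_rfl (by omega))
  -- the target dominates both `B` and `(C₀/R⁴)²`, and the a priori bound when `R < R₀`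
  have hmax0 : 0 ≤ max B ((max C₀ (2 * r.N * (R₀ : ℝ) ^ 4) / (R : ℝ) ^ 4) ^ 2) := le_max_of_le_left hB0
  have hmono : K * max B ((C₀ / (R : ℝ) ^ 4) ^ 2) ≤ K * max B ((max C₀ (2 * r.N * (R₀ : ℝ) ^ 4) / (R : ℝ) ^ 4) ^ 2) := by
    refine mul_le_mul_of_nonneg_left (max_le_max le_rfl ?_) hK0
    gcongr
    exact le_max_left _ _
  by_cases ht4 : t ≤ 4 * R + 1
  · by_cases hRR : R₀ ≤ R
    · exact (H' β hβ s hs hs1 hsub hpin L q k R B hq hR hRR h2Rs h8 hB t hRt htL ht4).trans hmono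
    · -- `R < R₀`: a priori bound
      have hRR' : R < R₀ := lt_of_not_ge hRR
      have hapr := abs_torusCov_plane_le_sq r β L q q (fun i => if i = k then (t : ℤ) else 0) (fun _ => 0)
      refine hapr.trans ?_
      calc 4 * (r.N : ℝ) ^ 2 ≤ (2 * r.N * (R₀ : ℝ) ^ 4 / (R : ℝ) ^ 4) ^ 2 := four_sq_le_of_lt (r.N : ℝ) hR hRR'
        _ ≤ (max C₀ (2 * r.N * (R₀ : ℝ) ^ 4) / (R : ℝ) ^ 4) ^ 2 := by
            gcongr
            exact le_max_right _ _
        _ ≤ max B ((max C₀ (2 * r.N * (R₀ : ℝ) ^ 4) / (R : ℝ) ^ 4) ^ 2) := le_max_right _ _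
        _ = 1 * _ := (one_mul _).symm
        _ ≤ K * max B ((max C₀ (2 * r.N * (R₀ : ℝ) ^ 4) / (R : ℝ) ^ 4) ^ 2) :=
            mul_le_mul_of_nonneg_right hK hmax0
  · -- old octave: the hypothesis
    have hold := hB t (by omega) htL
    calc _ ≤ B := hold
      _ ≤ max B ((max C₀ (2 * r.N * (R₀ : ℝ) ^ 4) / (R : ℝ) ^ 4) ^ 2) := le_max_left _ _
      _ = 1 * _ := (one_mul _).symm
      _ ≤ K * max B ((max C₀ (2 * r.N * (R₀ : ℝ) ^ 4) / (R : ℝ) ^ 4) ^ 2) :=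
          mul_le_mul_of_nonneg_right hK hmax0

/-! ## §3 D1: the large-`R` reduction -/

/-- **D1 large-`R` reduction.**  Fix any `R₀ : ℕ`.  If the D1 statement holds with its conclusion owed only for `R₀ ≤ R`
(hypothesis inserted after `1 ≤ R`; everything else VERBATIM, same `ℓ₄`, same `∀κ`), then D1 `PinnedTopOctaveCeiling` holds:
on `R < R₀` the a priori bound `|c| ≤ 4N² ≤ (2N R₀⁴/R⁴)² ≤ (C'/R⁴)²·(ℓ₄/(Rs))^M` (`C' := max C (2N R₀⁴)`, slack `≥ 1`
because `Rs ≤ ℓ₄`) does it. [bookkeeping + a priori bound] -/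
theorem pinnedTopOctaveCeiling_of_largeR (R₀ : ℕ)
    (h : ∀ (G : Type) [Group G] [TopologicalSpace G] [IsTopologicalGroup G] [CompactSpace G],
      IsCompactSimpleLieGroup G → Nonempty (G ≃ₜ* Matrix.specialUnitaryGroup (Fin 2) ℂ) →
      letI : MeasurableSpace G := borel G
      haveI : BorelSpace G := ⟨rfl⟩
      ∀ (r : LatticeRep G) (v f g h : SchwartzMap (EuclideanSpace ℝ (Fin 4)) ℝ) (Λ₅ : ℝ), ∃ ε₀ : ℝ, 0 < ε₀ ∧
        ∀ ε : ℝ, 0 < ε → ε ≤ ε₀ →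
          (∃ β₅ : ℝ, ∀ β : ℝ, β₅ ≤ β → ∃ s : ℝ, 0 < s ∧ s ≤ 1 ∧
              (∀ L : ℕ, Λ₅ ≤ s * L → ε ≤ Q2 G r β L s (thetaTest 4 v) v) ∧
              (∀ L : ℕ, Λ₅ ≤ s * L → ε ≤ |Q3 G r β L s f g h|)) →
          ∃ ℓ₄ : ℝ, 0 < ℓ₄ ∧ ∀ κ : ℝ, 0 < κ → κ ≤ 1 →
          ∃ (M : ℕ) (C β₄ : ℝ), 0 ≤ C ∧ ∀ β : ℝ, β₄ ≤ β → ∀ s : ℝ, 0 < s → s ≤ 1 →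
            (∀ s' : ℝ, 2 * s ≤ s' → s' ≤ 1 →
              ¬ ((∀ L : ℕ, Λ₅ ≤ s' * L → ε ≤ Q2 G r β L s' (thetaTest 4 v) v) ∧
                 (∀ L : ℕ, Λ₅ ≤ s' * L → ε ≤ |Q3 G r β L s' f g h|))) →
            ((∀ L : ℕ, Λ₅ ≤ s * L → ε ≤ Q2 G r β L s (thetaTest 4 v) v) ∧
              (∀ L : ℕ, Λ₅ ≤ s * L → ε ≤ |Q3 G r β L s f g h|)) →
            ∀ (L : ℕ) (q : Fin 4 × Fin 4) (k : Fin 4) (R t : ℕ), q.1 < q.2 → 1 ≤ R → R₀ ≤ R → (R : ℝ) * s ≤ ℓ₄ →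
              4 * R + 8 ≤ L → (κ * ℓ₄ < (R : ℝ) * s ∨ L < 8 * R + 8) → 2 * R + 2 ≤ t → t ≤ L →
              |torusE G r β L (fun U =>
                  (plane G r q (fun i => if i = k then (t : ℤ) else 0) U -
                      torusE G r β L (plane G r q (fun i => if i = k then (t : ℤ) else 0))) *
                    (plane G r q (fun _ => 0) U - torusE G r β L (plane G r q (fun _ => 0))))| ≤
                (C / (R : ℝ) ^ 4) ^ 2 * (ℓ₄ / ((R : ℝ) * s)) ^ M) :
    PinnedTopOctaveCeiling := by
  intro G _ _ _ _ hG hcl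
  letI : MeasurableSpace G := borel G
  haveI : BorelSpace G := ⟨rfl⟩
  intro r v f g h' Λ₅
  obtain ⟨ε₀, hε₀, H⟩ := h G hG hcl r v f g h' Λ₅
  refine ⟨ε₀, hε₀, fun ε hε hεε hfl => ?_⟩
  obtain ⟨ℓ₄, hℓ₄, H'⟩ := H ε hε hεε hfl
  refine ⟨ℓ₄, hℓ₄, fun κ hκ hκ1 => ?_⟩
  obtain ⟨M, C, β₄, hC, H''⟩ := H' κ hκ hκ1
  refine ⟨M, max C (2 * r.N * (R₀ : ℝ) ^ 4), β₄, le_max_of_le_left hC, ?_⟩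
  intro β hβ s hs hs1 hsub hpin L q k R t hq hR hRs hL hoct hRt htL
  have hr : (0 : ℝ) < R := by exact_mod_cast hR
  have hrs : 0 < (R : ℝ) * s := mul_pos hr hs
  have hslack : 1 ≤ (ℓ₄ / ((R : ℝ) * s)) ^ M := one_le_pow₀ ((one_le_div hrs).mpr hRs)
  have hmono : (C / (R : ℝ) ^ 4) ^ 2 * (ℓ₄ / ((R : ℝ) * s)) ^ M ≤
      (max C (2 * r.N * (R₀ : ℝ) ^ 4) / (R : ℝ) ^ 4) ^ 2 * (ℓ₄ / ((R : ℝ) * s)) ^ M := by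
    gcongr
    exact le_max_left _ _
  by_cases hRR : R₀ ≤ R
  · exact (H'' β hβ s hs hs1 hsub hpin L q k R t hq hR hRR hRs hL hoct hRt htL).trans hmono
  · have hRR' : R < R₀ := lt_of_not_ge hRR
    have hapr := abs_torusCov_plane_le_sq r β L q q (fun i => if i = k then (t : ℤ) else 0) (fun _ => 0)
    refine hapr.trans ?_
    calc 4 * (r.N : ℝ) ^ 2 ≤ (2 * r.N * (R₀ : ℝ) ^ 4 / (R : ℝ) ^ 4) ^ 2 := four_sq_le_of_lt (r.N : ℝ) hR hRR'
      _ ≤ (max C (2 * r.N * (R₀ : ℝ) ^ 4) / (R : ℝ) ^ 4) ^ 2 := by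
          gcongr
          exact le_max_right _ _
      _ = _ * 1 := (mul_one _).symm
      _ ≤ (max C (2 * r.N * (R₀ : ℝ) ^ 4) / (R : ℝ) ^ 4) ^ 2 * (ℓ₄ / ((R : ℝ) * s)) ^ M :=
          mul_le_mul_of_nonneg_left hslack (sq_nonneg _)

end Summit.QuantumFields.YangMills.Cruxes.HypercubicOSDataFromInfiniteVolume.TemperedCurrencies

end
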